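import Mathlib
import Literature.Analysis.FluidPDE.PressureRepresentation
import Literature.Analysis.FluidPDE.NewtonPotential
import Literature.Analysis.FluidPDE.IsometryInvariance
import Literature.Analysis.FluidPDE.HyperbolicDSSOrbit
import Literature.Analysis.FluidPDE.AxisymmetricVorticityTransport
import Literature.Analysis.FluidPDE.SelfSimilar
import Literature.Analysis.FluidPDE.PineauVicolGaussSobolev
import Literature.MathematicalPhysics.QuantumLattice.RestrictedLorentzConnected
import HarnessLib

/-!
# Twist normal form and O(3)-covariance bookkeeping for the E33 class theorems (pub-ns-dss,
  typer seat g6; route `DssFarFieldSlaving`, crux `BlowupTypeIDssProfile`,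
  stmt-NavierStokesRegularity-0155 — SUPPORT)

HONEST FRAMING. Pure bookkeeping (linear algebra of `O(3)`, rotation covariance of the
Calderón–Zygmund pressure potential, and the similarity change of variables); nothing here is
numerical and nothing here bears on Navier–Stokes regularity. The lemmas serve the general-twist
forms of the E33 sign-coherent class theorems (`…GaussianSignCoherentGeneralTwist.lean`), which so
far were typed only for a twist about the `e₃`-axis (`IsRotatedDSS c (rotZLIE (−θ)) u`).

CONTENTS.
* **Euler's rotation theorem** for linear isometries of `ℝ³` (`exists_unit_fixed_of_ldet_eq_one`:
  a linear isometry of determinant `1` fixes a unit vector — `det(N − 1) = det N · det(1 − N⁻¹)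
  = det(1 − Nᵀ) = det(1 − N) = −det(N − 1)`; `exists_eq_conj_rotZLIE_of_ldet_eq_one`: it is
  conjugate by a linear isometry to a rotation `rotZLIE θ` about `e₃`, via the tree's spherical
  coordinates `LorentzConnected.exists_rotZ_rotY_e3` and `LorentzConnected.exists_eq_rotZ_of_apply_e3`;
  `exists_trans_self_eq_conj_rotZLIE`: the SQUARE of ANY linear isometry of `ℝ³` is such a
  conjugate, `det R² = (det R)² = 1`).
* **`O(3)`-covariance of the pressure potential** `Q = pressurePotential`
  (`pressurePotential_conj`: `Q[L v L⁻¹](x) = Q[v](L⁻¹ x)` for every linear isometry `L`, with NO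
  hypothesis on `v` — the quadratic source is a divergence of rotation-covariant terms
  (`IsometryInvariance`), the kernels `Γ₀`, `D²Γ∞` are radial (`fderiv2_newtonFar_apply`), and `L`
  preserves Lebesgue measure).
* the similarity orbit of a conjugated field (`lerayOrbit_conj`) and the dictionary between the
  frame-free similarity form and the physical form of the E33 sign quantity
  (`inner_lerayOrbit_mul_eq`).
References: Koch–Nadirashvili–Seregin–Šverák, Acta Math. 203 (2009) §1 (symmetries of the class);
T. Tao, Anal. PDE 6 (2013) §4 (the normalised pressure). [folklore throughout]
-/

noncomputable section

set_option linter.dupNamespace false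

namespace Summit.NavierStokesRegularity.NavierStokesRegularity.Theorems.TwistNormalForm

open MeasureTheory Set Function Filter
open scoped RealInnerProductSpace
open Literature.Analysis Literature.Analysis.FluidPDE Literature.Analysis.FluidPDE.PineauVicol2026
open Literature.MathematicalPhysics.QuantumLattice

/-! ### A. Euler's rotation theorem for linear isometries of `ℝ³` -/

/-- **Euler's rotation theorem (fixed axis).** A linear isometry of `ℝ³` of determinant `1` fixes a
unit vector: `det(N − 1) = det N · det(1 − N⁻¹) = det(1 − Nᵀ) = det(1 − N) = −det(N − 1)`, so
`det(N − 1) = 0`. [folklore] -/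
theorem exists_unit_fixed_of_ldet_eq_one
    (N : EuclideanSpace ℝ (Fin 3) ≃ₗᵢ[ℝ] EuclideanSpace ℝ (Fin 3))
    (hdet : LorentzConnected.ldet N = 1) :
    ∃ n : EuclideanSpace ℝ (Fin 3), ‖n‖ = 1 ∧ N n = n := by
  set f : EuclideanSpace ℝ (Fin 3) →ₗ[ℝ] EuclideanSpace ℝ (Fin 3) :=
      (N.toLinearEquiv : EuclideanSpace ℝ (Fin 3) →ₗ[ℝ] EuclideanSpace ℝ (Fin 3)) with hf
  set g : EuclideanSpace ℝ (Fin 3) →ₗ[ℝ] EuclideanSpace ℝ (Fin 3) :=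
      (N.symm.toLinearEquiv : EuclideanSpace ℝ (Fin 3) →ₗ[ℝ] EuclideanSpace ℝ (Fin 3)) with hg
  have hdetf : LinearMap.det f = 1 := hdet
  have hfg : f ∘ₗ g = LinearMap.id := by
    apply LinearMap.ext
    intro x
    simp [hf, hg]
  have hadj : LinearMap.adjoint f = g := by
    have h := N.adjoint_toLinearMap_eq_symm
    exact h
  have hadj1 : LinearMap.adjoint (LinearMap.id - f) = LinearMap.id - g := by
    rw [map_sub, hadj]
    congr 1
    symm
    rw [LinearMap.eq_adjoint_iff]
    intro x y
    rfl
  have h1 : f - LinearMap.id = f ∘ₗ (LinearMap.id - g) := by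
    rw [LinearMap.comp_sub, LinearMap.comp_id, hfg]
  have hdetadj : ∀ φ : EuclideanSpace ℝ (Fin 3) →ₗ[ℝ] EuclideanSpace ℝ (Fin 3),
      LinearMap.det (LinearMap.adjoint φ) = LinearMap.det φ := fun φ => by
    -- matrix of the adjoint in an orthonormal basis = transpose (tree: `RoundCylinderThree.det_adjoint_eq`)
    rw [← LinearMap.det_toMatrix (EuclideanSpace.basisFun (Fin 3) ℝ).toBasis,
      LinearMap.toMatrix_adjoint (EuclideanSpace.basisFun (Fin 3) ℝ) (EuclideanSpace.basisFun
          (Fin 3) ℝ) φ,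
      Matrix.det_conjTranspose, star_trivial, LinearMap.det_toMatrix]
  have h2 : LinearMap.det (LinearMap.id - g) = LinearMap.det (LinearMap.id - f) := by
    rw [← hadj1, hdetadj]
  have h3 : LinearMap.det (LinearMap.id - f) = -LinearMap.det (f - LinearMap.id) := by
    have e : LinearMap.id - f = (-1 : ℝ) • (f - LinearMap.id) := by
      rw [neg_one_smul, neg_sub]
    rw [e, LinearMap.det_smul, finrank_euclideanSpace_fin]
    norm_num
  have h4 : LinearMap.det (f - LinearMap.id) = LinearMap.det (LinearMap.id - g) := by
    rw [h1, LinearMap.det_comp, hdetf, one_mul]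
  have hdet0 : LinearMap.det (f - LinearMap.id) = 0 := by linarith
  obtain ⟨v, hvker, hv0⟩ : ∃ v, v ∈ LinearMap.ker (f - LinearMap.id) ∧ v ≠ 0 := by
    have hlt := LinearMap.bot_lt_ker_of_det_eq_zero hdet0
    exact (Submodule.ne_bot_iff _).1 (bot_lt_iff_ne_bot.1 hlt)
  have hfv : f v = v := by
    have h := hvker
    rw [LinearMap.mem_ker, LinearMap.sub_apply, LinearMap.id_apply, sub_eq_zero] at h
    exact h
  have hNv : N v = v := hfv
  have hvn : ‖v‖ ≠ 0 := norm_ne_zero_iff.2 hv0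
  refine ⟨‖v‖⁻¹ • v, ?_, ?_⟩
  · rw [norm_smul, norm_inv, norm_norm, inv_mul_cancel₀ hvn]
  · rw [map_smul, hNv]

/-- The tree's two spellings of the rotation about `e₃` agree:
`LorentzConnected.rotZ θ = rotZLIE θ` (both are `(x₀,x₁,x₂) ↦ (cos θ x₀ − sin θ x₁, sin θ x₀ + cos θ x₁, x₂)`).
[folklore] -/
theorem rotZ_eq_rotZLIE (θ : ℝ) : LorentzConnected.rotZ θ = rotZLIE θ := by
  apply LinearIsometryEquiv.ext
  intro x
  ext i
  fin_cases i <;> simp [rotZ]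

/-- **Euler's rotation theorem (normal form).** A linear isometry `N` of `ℝ³` of determinant `1` is
conjugate by a linear isometry `P` to a rotation about the `e₃`-axis: `N = P ∘ rotZLIE θ ∘ P⁻¹`,
written `(P.symm.trans (rotZLIE θ)).trans P` (take `P = rotZ φ rotY ψ` with `P e₃ = n` the fixed
axis; `P⁻¹ N P` fixes `e₃` and has determinant `1`, hence is a `rotZ θ`). [folklore] -/
theorem exists_eq_conj_rotZLIE_of_ldet_eq_one
    (N : EuclideanSpace ℝ (Fin 3) ≃ₗᵢ[ℝ] EuclideanSpace ℝ (Fin 3))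
    (hdet : LorentzConnected.ldet N = 1) :
    ∃ (P : EuclideanSpace ℝ (Fin 3) ≃ₗᵢ[ℝ] EuclideanSpace ℝ (Fin 3)) (θ : ℝ), N = (P.symm.trans
        (rotZLIE θ)).trans P := by
  obtain ⟨n, hn1, hNn⟩ := exists_unit_fixed_of_ldet_eq_one N hdet
  obtain ⟨φ, ψ, hφψ⟩ := LorentzConnected.exists_rotZ_rotY_e3 n hn1
  set P : EuclideanSpace ℝ (Fin 3) ≃ₗᵢ[ℝ] EuclideanSpace ℝ (Fin 3) := LorentzConnected.rotZ φ
      * LorentzConnected.rotY ψ with hP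
  have hPe : P LorentzConnected.e3 = n := by
    rw [hP, LinearIsometryEquiv.coe_mul]
    exact hφψ
  set N' : EuclideanSpace ℝ (Fin 3) ≃ₗᵢ[ℝ] EuclideanSpace ℝ (Fin 3) := P⁻¹ * N * P with hN'
  have hN'e : N' LorentzConnected.e3 = LorentzConnected.e3 := by
    rw [hN', LinearIsometryEquiv.coe_mul, LinearIsometryEquiv.coe_mul, Function.comp_apply,
      Function.comp_apply, hPe, hNn, ← hPe, LinearIsometryEquiv.coe_inv,
      LinearIsometryEquiv.symm_apply_apply]
  have hPdet : LorentzConnected.ldet P = 1 := by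
    rw [hP, LorentzConnected.ldet_mul]
    change LinearMap.det
        ((LorentzConnected.rotZ φ).toLinearEquiv
        : EuclideanSpace ℝ (Fin 3) →ₗ[ℝ] EuclideanSpace ℝ (Fin 3)) *
      LinearMap.det
          ((LorentzConnected.rotY ψ).toLinearEquiv
          : EuclideanSpace ℝ (Fin 3) →ₗ[ℝ] EuclideanSpace ℝ (Fin 3)) = 1
    rw [LorentzConnected.det_rotZ, LorentzConnected.det_rotY, one_mul]
  have hN'det : LorentzConnected.ldet N' = 1 := by
    rw [hN', LorentzConnected.ldet_mul, LorentzConnected.ldet_mul, LorentzConnected.ldet_inv, hPdet,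
      hdet]
    norm_num
  obtain ⟨θ, hθ⟩ := LorentzConnected.exists_eq_rotZ_of_apply_e3 N' hN'det hN'e
  refine ⟨P, θ, ?_⟩
  have hNP : N = P * N' * P⁻¹ := by rw [hN']; group
  rw [hNP, hθ, rotZ_eq_rotZLIE]
  apply LinearIsometryEquiv.ext
  intro x
  simp only [LinearIsometryEquiv.coe_mul, LinearIsometryEquiv.coe_inv, Function.comp_apply,
    LinearIsometryEquiv.trans_apply]

/-- The square of a linear isometry of `ℝ³` has determinant `1` (`|det R| = 1`). [folklore] -/
theorem ldet_trans_self
    (R : EuclideanSpace ℝ (Fin 3) ≃ₗᵢ[ℝ] EuclideanSpace ℝ (Fin 3)) : LorentzConnected.ldet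
    (R.trans R) = 1 := by
  have h : R.trans R = R * R := rfl
  rw [h, LorentzConnected.ldet_mul]
  have habs := LorentzConnected.abs_ldet R
  nlinarith [abs_mul_abs_self (LorentzConnected.ldet R)]

/-- **The square of any linear isometry of `ℝ³` is conjugate to a rotation about the `e₃`-axis**:
`R ∘ R = P ∘ rotZLIE θ ∘ P⁻¹` for some linear isometry `P` and angle `θ` (`det R² = 1` and Euler's
rotation theorem). For `det R = −1` this is how a rotoreflection twist is reduced to a rotation
twist at the squared factor. [folklore] -/
theorem exists_trans_self_eq_conj_rotZLIE
    (R : EuclideanSpace ℝ (Fin 3) ≃ₗᵢ[ℝ] EuclideanSpace ℝ (Fin 3)) :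
    ∃ (P : EuclideanSpace ℝ (Fin 3) ≃ₗᵢ[ℝ] EuclideanSpace ℝ (Fin 3)) (θ : ℝ), R.trans R =
        (P.symm.trans (rotZLIE θ)).trans P :=
  exists_eq_conj_rotZLIE_of_ldet_eq_one _ (ldet_trans_self R)

/-! ### B. `O(3)`-covariance of the Calderón–Zygmund pressure potential -/

section Pressure

variable (L : EuclideanSpace ℝ (Fin 3) ≃ₗᵢ[ℝ] EuclideanSpace ℝ (Fin 3))

/-- The quadratic pressure source `G[v] = ∂ᵢ∂ⱼ(vᵢvⱼ)` of a conjugated field: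
`G[L v L⁻¹](x) = G[v](L⁻¹ x)` (no hypothesis on `v`). [folklore] -/
theorem pressureSource_conj (v : EuclideanSpace ℝ (Fin 3) → EuclideanSpace ℝ (Fin 3))
    (x : EuclideanSpace ℝ (Fin 3)) :
    pressureSource (fun y => L (v (L.symm y))) x = pressureSource v (L.symm x) := by
  rw [pressureSource, pressureSource]
  set F : EuclideanSpace ℝ (Fin 3) → EuclideanSpace ℝ (Fin 3)
      := fun z => convect v v z + VectorCalculus.divergence v z • v z with hFdef
  have hF : (fun y => convect (fun y => L (v (L.symm y))) (fun y => L (v (L.symm y))) y +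
      VectorCalculus.divergence (fun y => L (v (L.symm y))) y • L (v (L.symm y))) =
      fun y => L (F (L.symm y)) := by
    funext y
    rw [convect_conj_linearIsometryEquiv, divergence_conj_linearIsometryEquiv, hFdef, map_add,
        map_smul]
  rw [hF, divergence_conj_linearIsometryEquiv]

/-- The near kernel `Γ₀` is radial: `Γ₀(L z) = Γ₀(z)`. [folklore] -/
theorem newtonNear_map (r₀ r₁ : ℝ) (z : EuclideanSpace ℝ (Fin 3)) : newtonNear r₀ r₁
    (L z) = newtonNear r₀ r₁ z := by
  simp only [newtonNear, radialCutoff, newtonKernel, LinearIsometryEquiv.norm_map]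

/-- The Hessian of the far kernel `Γ∞` is rotation covariant:
`D²Γ∞(L z)(L a, L b) = D²Γ∞(z)(a, b)` (explicit radial Hessian `fderiv2_newtonFar_apply`). [folklore] -/
theorem fderiv2_newtonFar_map {r₀ r₁ : ℝ} (h₀ : 0 < r₀) (h₁ : r₀ < r₁)
    (z a b : EuclideanSpace ℝ (Fin 3)) :
    fderiv ℝ (fderiv ℝ (newtonFar r₀ r₁)) (L z) (L a) (L b) =
      fderiv ℝ (fderiv ℝ (newtonFar r₀ r₁)) z a b := by
  rw [fderiv2_newtonFar_apply h₀ h₁, fderiv2_newtonFar_apply h₀ h₁]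
  simp only [LinearIsometryEquiv.inner_map_map, LinearIsometryEquiv.norm_map]

/-- The near potential of a conjugated field: `Q₁[L v L⁻¹](x) = Q₁[v](L⁻¹ x)` (substitute
`z = L w`; `L` preserves Lebesgue measure). [folklore] -/
theorem nearPotential_conj (r₀ r₁ : ℝ) (v : EuclideanSpace ℝ (Fin 3) → EuclideanSpace ℝ (Fin 3))
    (x : EuclideanSpace ℝ (Fin 3)) :
    nearPotential r₀ r₁ (fun y => L (v (L.symm y))) x = nearPotential r₀ r₁ v (L.symm x) := by
  rw [nearPotential, nearPotential]
  have hmp := L.measurePreserving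
  rw [← hmp.integral_comp' (f := L.toMeasurableEquiv)
    (g := fun z => newtonNear r₀ r₁ z * pressureSource (fun y => L (v (L.symm y))) (x - z))]
  refine integral_congr_ae (Eventually.of_forall fun w => ?_)
  simp only [LinearIsometryEquiv.coe_toMeasurableEquiv]
  rw [newtonNear_map, pressureSource_conj, map_sub, LinearIsometryEquiv.symm_apply_apply]

/-- The far potential of a conjugated field: `Q₂[L v L⁻¹](x) = Q₂[v](L⁻¹ x)` (substitute
`y = L w`). [folklore] -/
theorem farPotential_conj {r₀ r₁ : ℝ} (h₀ : 0 < r₀) (h₁ : r₀ < r₁)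
    (v : EuclideanSpace ℝ (Fin 3) → EuclideanSpace ℝ (Fin 3)) (x : EuclideanSpace ℝ (Fin 3)) :
    farPotential r₀ r₁ (fun y => L (v (L.symm y))) x = farPotential r₀ r₁ v (L.symm x) := by
  rw [farPotential, farPotential]
  have hmp := L.measurePreserving
  rw [← hmp.integral_comp' (f := L.toMeasurableEquiv)
    (g := fun y => fderiv ℝ (fderiv ℝ (newtonFar r₀ r₁)) (x - y) (L (v (L.symm y)))
      (L (v (L.symm y))))]
  refine integral_congr_ae (Eventually.of_forall fun w => ?_)
  simp only [LinearIsometryEquiv.coe_toMeasurableEquiv, LinearIsometryEquiv.symm_apply_apply]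
  have e : x - L w = L (L.symm x - w) := by rw [map_sub, LinearIsometryEquiv.apply_symm_apply]
  rw [e, fderiv2_newtonFar_map L h₀ h₁]

/-- **`O(3)`-covariance of the pressure potential**: `Q[L v L⁻¹](x) = Q[v](L⁻¹ x)` for every
linear isometry `L` of `ℝ³`, every field `v` and every point `x` (no regularity or decay
hypothesis: both sides are the same integrals after the substitution `y = L w`). [folklore] -/
theorem pressurePotential_conj (v : EuclideanSpace ℝ (Fin 3) → EuclideanSpace ℝ (Fin 3))
    (x : EuclideanSpace ℝ (Fin 3)) :
    pressurePotential (fun y => L (v (L.symm y))) x = pressurePotential v (L.symm x) := by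
  rw [pressurePotential, pressurePotential, nearPotential_conj,
      farPotential_conj L one_pos one_lt_two]

/-- Symmetric spelling: `Q[L⁻¹ v L](x) = Q[v](L x)`. [folklore] -/
theorem pressurePotential_conj_symm (v : EuclideanSpace ℝ (Fin 3) → EuclideanSpace ℝ (Fin 3))
    (x : EuclideanSpace ℝ (Fin 3)) :
    pressurePotential (fun y => L.symm (v (L y))) x = pressurePotential v (L x) := by
  simpa only [LinearIsometryEquiv.symm_symm] using pressurePotential_conj L.symm v x

end Pressure

/-! ### C. Similarity orbit of a conjugated field; the E33 sign quantity in physical variables -/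

/-- The similarity orbit of a conjugated field is the conjugated orbit:
`lerayOrbit (L V L⁻¹) s y = L (lerayOrbit V s (L⁻¹ y))`. [folklore] -/
theorem lerayOrbit_conj (L : EuclideanSpace ℝ (Fin 3) ≃ₗᵢ[ℝ] EuclideanSpace ℝ (Fin 3))
    (V : ℝ → EuclideanSpace ℝ (Fin 3) → EuclideanSpace ℝ (Fin 3)) (s : ℝ)
    (y : EuclideanSpace ℝ (Fin 3)) :
    lerayOrbit (fun t x => L (V t (L.symm x))) s y = L (lerayOrbit V s (L.symm y)) := by
  simp only [lerayOrbit_apply, map_smul]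

/-- Symmetric spelling of `lerayOrbit_conj`. [folklore] -/
theorem lerayOrbit_conj_symm (L : EuclideanSpace ℝ (Fin 3) ≃ₗᵢ[ℝ] EuclideanSpace ℝ (Fin 3))
    (V : ℝ → EuclideanSpace ℝ (Fin 3) → EuclideanSpace ℝ (Fin 3)) (s : ℝ)
    (y : EuclideanSpace ℝ (Fin 3)) :
    lerayOrbit (fun t x => L.symm (V t (L x))) s y = L.symm (lerayOrbit V s (L y)) := by
  simp only [lerayOrbit_apply, map_smul]

/-- **The E33 sign quantity in similarity variables is `e^{−s}` times the physical one.** With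
`t = −e^{−s}`, `x = e^{−s/2} y`, `U = lerayOrbit V s y` and the transported Calderón–Zygmund pressure
`P = e^{−s} Q[V(t)](x)`:  `⟪y, U⟫ (½|U|² + P) = e^{−s} · ⟪x, V(t,x)⟫ (½|V(t,x)|² + Q[V(t)](x))`.
In particular the two pointwise sign conditions are equivalent. [folklore] -/
theorem inner_lerayOrbit_mul_eq (V : ℝ → EuclideanSpace ℝ (Fin 3) → EuclideanSpace ℝ (Fin 3))
    (s : ℝ) (y : EuclideanSpace ℝ (Fin 3)) :
    ⟪y, lerayOrbit V s y⟫ * (2⁻¹ * ‖lerayOrbit V s y‖ ^ 2 +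
        Real.exp (-s) * pressurePotential (V (-Real.exp (-s))) (Real.exp (-s / 2) • y)) =
      Real.exp (-s) * (⟪Real.exp (-s / 2) • y, V (-Real.exp (-s)) (Real.exp (-s / 2) • y)⟫ *
        (2⁻¹ * ‖V (-Real.exp (-s)) (Real.exp (-s / 2) • y)‖ ^ 2 +
          pressurePotential (V (-Real.exp (-s))) (Real.exp (-s / 2) • y))) := by
  rw [lerayOrbit_apply]
  set a : ℝ := Real.exp (-s / 2) with ha_def
  set w : EuclideanSpace ℝ (Fin 3) := V (-Real.exp (-s)) (a • y)
  set Q : ℝ := pressurePotential (V (-Real.exp (-s))) (a • y)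
  have ha : Real.exp (-s) = a * a := by rw [ha_def, ← Real.exp_add]; ring_nf
  have hapos : 0 < a := Real.exp_pos _
  rw [ha, real_inner_smul_right, real_inner_smul_left, norm_smul, Real.norm_eq_abs,
      abs_of_pos hapos]
  ring

/-! ### D. Small rotation-invariance helpers for the co-rotating frame and the Gaussian pairing -/

/-- `⟪y, R_{−b} u⟫ = ⟪R_b y, u⟫`
    (`R_b = rotZ b` is an isometry with inverse `R_{−b}`). [folklore] -/
theorem inner_rotZ_neg (b : ℝ) (y u : EuclideanSpace ℝ (Fin 3)) : ⟪y, rotZ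
    (-b) u⟫ = ⟪rotZ b y, u⟫ := by
  rw [← rotZLIE_symm_apply, ← rotZLIE_apply, ← LinearIsometryEquiv.inner_map_map (rotZLIE b) y,
    LinearIsometryEquiv.apply_symm_apply]

/-- `⟪z, P⁻¹ u⟫ = ⟪P z, u⟫` for a linear isometry `P`. [folklore] -/
theorem inner_symm_right (P : EuclideanSpace ℝ (Fin 3) ≃ₗᵢ[ℝ] EuclideanSpace ℝ (Fin 3))
    (z u : EuclideanSpace ℝ (Fin 3)) : ⟪z, P.symm u⟫ = ⟪P z, u⟫ := by
  rw [← LinearIsometryEquiv.inner_map_map P z, LinearIsometryEquiv.apply_symm_apply]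

/-- The Gaussian weight `γ(y) = e^{−|y|²/4}` is rotation invariant. [folklore] -/
theorem gaussWeight_map (L : EuclideanSpace ℝ (Fin 3) ≃ₗᵢ[ℝ] EuclideanSpace ℝ (Fin 3))
    (y : EuclideanSpace ℝ (Fin 3)) : gaussWeight (L y) = gaussWeight y := by
  simp only [gaussWeight, LinearIsometryEquiv.norm_map]

/-- Substitution `y = L w` in a Lebesgue integral over `ℝ³`
    (`L` a linear isometry preserves Lebesgue
measure). [folklore] -/
theorem integral_comp_linearIsometryEquiv {F : Type*} [NormedAddCommGroup F] [NormedSpace ℝ F]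
    (L : EuclideanSpace ℝ (Fin 3) ≃ₗᵢ[ℝ] EuclideanSpace ℝ (Fin 3))
        (G : EuclideanSpace ℝ (Fin 3) → F) : ∫ y, G (L y) = ∫ y, G y := by
  have h := L.measurePreserving.integral_comp' (f := L.toMeasurableEquiv) (g := G)
  simpa only [LinearIsometryEquiv.coe_toMeasurableEquiv] using h

/-- A Gaussian pairing is unchanged when the paired function is precomposed with a linear isometry:
`∫ γ(y) F(L y) dy = ∫ γ(y) F(y) dy`. [folklore] -/
theorem integral_gaussWeight_mul_comp
    (L : EuclideanSpace ℝ (Fin 3) ≃ₗᵢ[ℝ] EuclideanSpace ℝ (Fin 3))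
    (F : EuclideanSpace ℝ (Fin 3) → ℝ) :
    ∫ y, gaussWeight y * F (L y) = ∫ y, gaussWeight y * F y := by
  have h := integral_comp_linearIsometryEquiv L (fun w => gaussWeight w * F w)
  simp only [gaussWeight_map] at h
  exact h

end Summit.NavierStokesRegularity.NavierStokesRegularity.Theorems.TwistNormalForm
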